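import Mathlib
import HarnessLib
import Summits.QuantumFields.QCD.Statement
import Summits.QuantumFields.QCD.Theses.OverlapPositivityTransfer
import Literature.MathematicalPhysics.QuantumFieldTheory.QCDOS
import Literature.MathematicalPhysics.QuantumFieldTheory.OverlapQCDOS

/-!
# `WilsonOverlapTransfer` (stmt-QuantumFields-17582) — costume analysis and the best typed decomposition

crux-strategist r1 (REDIRECT), `cstrat-stmt-QuantumFields-17582-r1`, 2026-08-17.  Companion of
`Cruxes/WilsonOverlapTransfer/STRATEGY-CENSUS.md`.  Nothing here is an item; nothing is filed.

The crux is `C := (∀ N_f ∈ {2,3}, OverlapChiralQCDOf N_f) → QCD`, i.e. `C = (H → S)` with `S = QCD` the sub-problem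
Statement and `H` ("the overlap body") the JOINT CONCLUSION of the route's three other load-bearing cruxes
(`OverlapLatticeGap`, `OverlapGoldstone`, `OverlapContinuumLimit`; see `closes`).

§1 records the three formal facts behind the verdict `no-strategy`:
* `costume_facts.1 : QCD → C` — `C` is a CONSEQUENCE of `S` (BC2 converse probe closes; BC7 `crux.summit-implies`);
* `costume_facts.2.1 : H → (C ↔ QCD)` — modulo its siblings the deciding crux is LITERALLY the summit: once the overlap
  body is proved, proving `C` and proving `QCD` are the same task with `H` available as a free lemma;
* `costume_facts.2.2 : C ↔ (QCD ∨ ¬ H)` — classically, `C` is true iff the summit holds or the route's own thesis fails.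
So `C` carries content short of `S` exactly to the extent that `H` can be USED in a proof of `S`; the census explains why
no known or conjectured mechanism uses it for the two fixed-cutoff INFRARED clauses of `QCDOf` (the uniform Wilson lattice
gap `HasLatticeMassGap` at every positive mass, and Wilson gap closure `IsChiralAtZero`).

§2 is the best TYPED decomposition found, `C ⇐ SchwingerUniversality ∧ LatticeInfraredTransfer`, with the assembly
`wilsonOverlapTransfer_of_subs` PROVED (no sorry):
* `SchwingerUniversality` (honest, ultraviolet): every overlap regularisation with leading-log mass scaling has a Wilson
  regularisation with leading-log mass scaling that is SCHWINGER-MATCHED to it — every OS datum `T` reached by the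
  renormalised admissible-overlap lattice Schwinger functions at renormalised masses `m` (`IsOverlapQCDAlong`) is reached,
  at the same `m` and with re-renormalised species, by the Wilson lattice Schwinger functions (`IsQCDAlong`).  This is the
  non-perturbative form of Reisz's perturbative universality; it transfers `IsQCDAlong` and, with the SAME `T`, every
  `T`-level clause of `QCDOf` (non-triviality, non-Gaussianity, dynamical flavours, `T.HasMassGap`) for free.
* `LatticeInfraredTransfer` (the costume half): for Schwinger-matched pairs, the overlap gap closure at zero mass forces
  Wilson's `IsChiralAtZero`, and a uniform overlap-lattice gap at mass `m` forces a uniform Wilson-lattice gap at `m`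
  (rate `Δ' ≤ Δ`).  Both are statements about ALL gauge-invariant local lattice observables of the WILSON theory at every
  fixed large cutoff, uniformly in the volume; the hypothesis offers per-pair torus clustering of a DIFFERENT lattice
  theory and agreement of finitely many smeared species correlators in the limit — no handle (census §Decomposition).
  The matching predicate is guarded (`HonestlyMatched`: some non-trivial OS datum is actually reached) so that the piece
  is not refutable through a vacuously matched pair.
-/

namespace Summit.QuantumFields.QCD.Cruxes.WilsonOverlapTransfer

open Filter Topology
open Literature.MathematicalPhysics.QuantumFieldTheory
open Summit.QuantumFields.QCD.Theses.OverlapPositivityTransfer (WilsonOverlapTransfer)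

/-! ## §1 The crux relative to the summit -/

/-- The overlap body: the joint conclusion of the route's other load-bearing cruxes (hypothesis of the transfer). -/
def OverlapBody : Prop :=
  ∀ Nf : ℕ, Nf = 2 ∨ Nf = 3 → OverlapChiralQCDOf Nf

/-- The crux is, by definition, `OverlapBody → QCD`. -/
theorem wilsonOverlapTransfer_iff : WilsonOverlapTransfer ↔ (OverlapBody → QCD) := Iff.rfl

/-- **The three costume facts** (bundled into one conjunction so that no declaration of this scratch file has the
crux as its literal type): (i) **S → C** — the crux is a consequence of the summit (it discards its hypothesis);
(ii) **modulo the siblings the crux is the summit** — given the overlap body, `C ↔ QCD`; (iii) **truth-value content**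
(classical) — the transfer holds iff the summit holds or the overlap programme (the route's own thesis) fails. -/
theorem costume_facts :
    (QCD → WilsonOverlapTransfer) ∧
      (OverlapBody → (WilsonOverlapTransfer ↔ QCD)) ∧
        (WilsonOverlapTransfer ↔ (QCD ∨ ¬ OverlapBody)) := by
  refine ⟨fun h _ => h, fun hB => ⟨fun hC => hC hB, fun h _ => h⟩, fun hC => ?_,
    fun h hB => h.elim id fun hnB => absurd hB hnB⟩
  by_cases hB : OverlapBody
  · exact Or.inl (hC hB)
  · exact Or.inr hB

/-! ## §2 The best typed decomposition: Schwinger universality (UV) ∧ lattice infrared transfer (IR) -/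

variable {Nf : ℕ}

/-- **Schwinger matching** of a Wilson regularisation `regW` to an overlap regularisation `regO`: every OS datum reached
by the admissible-overlap lattice Schwinger functions along `regO` at renormalised masses `m` (some species
renormalisations) is reached by the Wilson lattice Schwinger functions along `regW` at the same `m` (some species
renormalisations) — two-loop asymptotic scaling and the physical branch `m_f(k) > −1` included (`IsQCDAlong`). -/
def SchwingerMatched (regO regW : QCDRegularisation Nf) : Prop :=
  ∀ m : Fin Nf → ℝ, (∀ f, 0 < m f) → ∀ (z shift : QCDField Nf → ℕ → ℝ) (T : OSData (QCDField Nf) 4),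
    IsOverlapQCDAlong (regO.scheme m z shift) T →
      ∃ z' shift' : QCDField Nf → ℕ → ℝ, IsQCDAlong (regW.scheme m z' shift') T

/-- **Honest matching**: Schwinger-matched AND non-vacuous — along `regO` some positive mass tuple actually reaches an OS
datum with a non-trivial gluonic field (so a matched `regW` is genuinely tied to `regO`). -/
def HonestlyMatched (regO regW : QCDRegularisation Nf) : Prop :=
  SchwingerMatched regO regW ∧
    ∃ m : Fin Nf → ℝ, (∀ f, 0 < m f) ∧ ∃ (z shift : QCDField Nf → ℕ → ℝ) (T : OSData (QCDField Nf) 4),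
      IsOverlapQCDAlong (regO.scheme m z shift) T ∧ T.IsNontrivial QCDField.glue

/-- **Piece X₁ — Schwinger-function universality overlap ⇒ Wilson** (non-perturbative Reisz; ultraviolet): every
overlap regularisation with leading-log mass scaling admits a Schwinger-matched Wilson regularisation with leading-log
mass scaling (matched Λ-parameters via `afBeta`, `m_crit(k)` tuned to the Wilson chiral critical line, `Z_m` ratio,
species re-renormalised). -/
def SchwingerUniversality : Prop :=
  ∀ Nf : ℕ, Nf = 2 ∨ Nf = 3 → ∀ regO : QCDRegularisation Nf, regO.HasMassScaling →
    ∃ regW : QCDRegularisation Nf, regW.HasMassScaling ∧ SchwingerMatched regO regW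

/-- **Piece X₂ — lattice infrared transfer at fixed cutoff** (the costume half): for honestly matched pairs, overlap gap
closure at zero mass gives Wilson's `IsChiralAtZero`, and a uniform overlap-lattice gap `Δ` at mass `m` gives a uniform
Wilson-lattice gap `Δ' ∈ (0, Δ]` at `m` (for ALL gauge-invariant local lattice observables, all large `k`, all tori,
uniformly in the volume). -/
def LatticeInfraredTransfer : Prop :=
  ∀ Nf : ℕ, Nf = 2 ∨ Nf = 3 → ∀ regO regW : QCDRegularisation Nf,
    regO.HasMassScaling → regW.HasMassScaling → HonestlyMatched regO regW →
      (regO.OverlapGapClosesAtZero → regW.IsChiralAtZero) ∧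
        ∀ m : Fin Nf → ℝ, (∀ f, 0 < m f) → ∀ (z shift : QCDField Nf → ℕ → ℝ) (Δ : ℝ), 0 < Δ →
          (regO.scheme m z shift).OverlapHasLatticeMassGap Δ →
            ∃ Δ' : ℝ, 0 < Δ' ∧ Δ' ≤ Δ ∧
              ∀ z' shift' : QCDField Nf → ℕ → ℝ, (regW.scheme m z' shift').HasLatticeMassGap Δ'

/-- The OS mass gap is antitone in the rate (constants enlarged to `max C 0`). -/
theorem hasMassGap_anti {ι : Type} {T : OSData ι 4} {Δ Δ' : ℝ} (h : T.HasMassGap Δ) (hle : Δ' ≤ Δ) :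
    T.HasMassGap Δ' := by
  intro n m k k' F G hF hG
  obtain ⟨C, hC⟩ := h n m k k' F G hF hG
  refine ⟨max C 0, fun t ht H hH => (hC t ht H hH).trans ?_⟩
  calc C * Real.exp (-Δ * t) ≤ max C 0 * Real.exp (-Δ * t) :=
        mul_le_mul_of_nonneg_right (le_max_left _ _) (Real.exp_pos _).le
    _ ≤ max C 0 * Real.exp (-Δ' * t) :=
        mul_le_mul_of_nonneg_left (Real.exp_le_exp.2 (by nlinarith)) (le_max_right _ _)

/-- **Assembly of the decomposition (PROVED)**: Schwinger universality and lattice infrared transfer imply the crux. -/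
theorem wilsonOverlapTransfer_of_subs :
    SchwingerUniversality → LatticeInfraredTransfer → WilsonOverlapTransfer := by
  intro hU hIR hBody
  have key : ∀ Nf : ℕ, Nf = 2 ∨ Nf = 3 → QCDOf Nf := by
    intro Nf hNf
    obtain ⟨regO, hMSO, hχO, hbody⟩ := hBody Nf hNf
    obtain ⟨regW, hMSW, hmatch⟩ := hU Nf hNf regO hMSO
    -- non-vacuity witness: N_f ≥ 1 positive masses all equal to 1
    have hone : ∀ f : Fin Nf, (0 : ℝ) < (fun _ => (1 : ℝ)) f := fun _ => one_pos
    obtain ⟨z₁, shift₁, T₁, hAlong₁, hNT₁, -⟩ := hbody (fun _ => 1) hone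
    have hhon : HonestlyMatched regO regW := ⟨hmatch, fun _ => 1, hone, z₁, shift₁, T₁, hAlong₁, hNT₁⟩
    obtain ⟨hχW, hgapW⟩ := hIR Nf hNf regO regW hMSO hMSW hhon
    refine ⟨regW, hMSW, hχW hχO, fun m hm => ?_⟩
    obtain ⟨z, shift, T, hAlong, hNT, hNG, hdyn, Δ, hΔ, hgapT, hgapL⟩ := hbody m hm
    obtain ⟨z', shift', hAlongW⟩ := hmatch m hm z shift T hAlong
    obtain ⟨Δ', hΔ', hle, hgapW'⟩ := hgapW m hm z shift Δ hΔ hgapL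
    exact ⟨z', shift', T, hAlongW, hNT, hNG, hdyn, Δ', hΔ', hasMassGap_anti hgapT hle, hgapW' z' shift'⟩
  exact ⟨key 2 (Or.inl rfl), key 3 (Or.inr rfl)⟩

/-- The lattice-gap clause does not read the species renormalisations (sanity check for X₂'s `∀ z' shift'`). -/
theorem hasLatticeMassGap_scheme_irrel (reg : QCDRegularisation Nf) (m : Fin Nf → ℝ)
    (z shift : QCDField Nf → ℕ → ℝ) (Δ : ℝ) :
    (reg.scheme m z shift).HasLatticeMassGap Δ ↔ (reg.scheme m 0 0).HasLatticeMassGap Δ :=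
  Iff.rfl

end Summit.QuantumFields.QCD.Cruxes.WilsonOverlapTransfer
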